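import Summits.RiemannHypothesis.RiemannHypothesis.Theorems.SoloInformedGroundStatePairing
import Summits.RiemannHypothesis.RiemannHypothesis.Theorems.SoloInformedGroundStateDecay2
import Literature.NumberTheory.LFunctions.ZeroSumWindowBounds

/-!
# Ground-state endgame, V-d: explicit unit near-null vectors of the `ℓ¹` zero pairing

Solo programme `solo-RiemannHypothesis-informed`, session 3 (part 4 of the operator-free endgame).
Everything here is proved unconditionally.

The visibility criterion (`riemannHypothesis_of_visible_groundStates_subexp`, part 3) asks that the
ground state `u_a` of the window `[-a, a]` be within `L²`-distance `√δ < 1` of a window test `k`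
whose `ℓ¹` zero sum `Z₁(k; T) = Σ_{0<|Im ρ|≤T} m(ρ)|k̂(ρ)|` satisfies `Z₁(k; ·) E(a) ≤ B e^{κa}`,
`E(a) = e^{a/2}√(2a)`.  Here we show that this hypothesis is not about the EXISTENCE of such
near-null vectors but only about their ANGLE to the ground state: for every `a ≥ a₁` there is a
window test `k_a` with

  `‖k_a‖₂ = 1`  and  `Z₁(k_a; T) · E(a) ≤ C`  for all `T`

(`exists_unit_nearNull_window`), with an absolute constant `C`.  The vector is the normalised
session-2 test `decayTest2 λ`, `a = log(λ+1) + 1` (`exists_unit_nearNull_decayRadius`): its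
transform is `O(2^{-M(λ)}/(1+γ²))` at every non-trivial zero, `M(λ) ≍ λ²`
(`norm_weilMellin_decayTest2_le`, extracted from part XVI), its norm is `≫ λ² e^{-3a/2}/√(2a)`
(`integral_norm_sq_ge_of_support`), and `Σ_ρ m(ρ)/(1+γ²) < ∞`
(`summable_zeroOrder_div_one_add_im_sq`, from the tree's zero-window bounds) turns the pointwise
bound into an `ℓ¹` bound (`zeroSumAbs_le_of_norm_le_inv`).  In fact the proof gives
`Z₁(k_a) E(a) ≤ C' λ² 2^{-M(λ)}`, doubly exponentially small in `a`; only boundedness is recorded.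
-/

noncomputable section

open Complex Filter Set Topology Metric MeasureTheory
open Literature.NumberTheory.LFunctions Literature.NumberTheory.LFunctions.WeilContinuous
open scoped ComplexConjugate

namespace Summit.RiemannHypothesis.RiemannHypothesis.Theorems

/-! ## The counting step with the weight `1/(1+γ²)` -/

section Counting

/-- `Σ_ρ m(ρ)/(1+γ²) < ∞` over the non-trivial zeros (the tree's window bound
`ZetaZeroSum.exists_tsum_zeroOrder_div_sq_le` at `t = 0`, `c = 1`). -/
theorem summable_zeroOrder_div_one_add_im_sq :
    Summable fun ρ : ZetaZeros.riemannZetaNontrivialZeros ↦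
      (riemannZetaZeroOrder (ρ : ℂ) : ℝ) / (1 + (ρ : ℂ).im ^ 2) := by
  obtain ⟨C, -, hC⟩ := ZetaZeroSum.exists_tsum_zeroOrder_div_sq_le
  have h : Summable fun ρ : ZetaZeros.riemannZetaNontrivialZeros ↦
      (riemannZetaZeroOrder (ρ : ℂ) : ℝ) / ((1 : ℝ) ^ 2 + ((ρ : ℂ).im - 0) ^ 2) :=
    (hC 0 1 one_pos le_rfl).1
  refine h.congr fun ρ ↦ ?_
  rw [one_pow, sub_zero]

/-- `Σ_ρ m(ρ)/(1+γ²) ≥ 0`. -/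
theorem tsum_zeroOrder_div_one_add_im_sq_nonneg :
    0 ≤ ∑' ρ : ZetaZeros.riemannZetaNontrivialZeros,
      (riemannZetaZeroOrder (ρ : ℂ) : ℝ) / (1 + (ρ : ℂ).im ^ 2) :=
  tsum_nonneg fun ρ ↦ div_nonneg
    (by
      exact_mod_cast riemannZetaZeroOrder_nonneg (ZetaZeros.riemannZetaNontrivialZeros.ne_one ρ.2))
    (by positivity)

/-- **Counting step, weight `1/(1+γ²)`.** A pointwise bound `|k̂(ρ)| ≤ A₀/(1+γ²)` at the
non-trivial zeros gives `Z₁(k; T) ≤ A₀ · Σ_ρ m(ρ)/(1+γ²)` for every `T`. -/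
theorem zeroSumAbs_le_of_norm_le_inv {k : ℝ → ℂ} {A₀ : ℝ}
    (h : ∀ ρ ∈ ZetaZeros.riemannZetaNontrivialZeros, ‖weilMellin k ρ‖ ≤ A₀ / (1 + ρ.im ^ 2))
    (T : ℝ) :
    ∑ᶠ ρ ∈ weilZeroIndex T, (riemannZetaZeroOrder ρ : ℝ) * ‖weilMellin k ρ‖ ≤
      A₀ * ∑' ρ : ZetaZeros.riemannZetaNontrivialZeros,
        (riemannZetaZeroOrder (ρ : ℂ) : ℝ) / (1 + (ρ : ℂ).im ^ 2) := by
  rw [finsum_weilZeroIndex_eq_sum (fun ρ ↦ (riemannZetaZeroOrder ρ : ℝ) * ‖weilMellin k ρ‖),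
    ← tsum_mul_left]
  have hm : ∀ ρ : ZetaZeros.riemannZetaNontrivialZeros, (0 : ℝ) ≤ riemannZetaZeroOrder (ρ : ℂ) :=
    fun ρ ↦ by
      exact_mod_cast riemannZetaZeroOrder_nonneg (ZetaZeros.riemannZetaNontrivialZeros.ne_one ρ.2)
  have hle : ∀ ρ : ZetaZeros.riemannZetaNontrivialZeros,
      (riemannZetaZeroOrder (ρ : ℂ) : ℝ) * ‖weilMellin k ρ‖ ≤
        A₀ * ((riemannZetaZeroOrder (ρ : ℂ) : ℝ) / (1 + (ρ : ℂ).im ^ 2)) := by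
    intro ρ
    calc (riemannZetaZeroOrder (ρ : ℂ) : ℝ) * ‖weilMellin k ρ‖
        ≤ (riemannZetaZeroOrder (ρ : ℂ) : ℝ) * (A₀ / (1 + (ρ : ℂ).im ^ 2)) :=
          mul_le_mul_of_nonneg_left (h ρ ρ.2) (hm ρ)
      _ = A₀ * ((riemannZetaZeroOrder (ρ : ℂ) : ℝ) / (1 + (ρ : ℂ).im ^ 2)) := by ring
  have hsum : Summable fun ρ : ZetaZeros.riemannZetaNontrivialZeros ↦
      A₀ * ((riemannZetaZeroOrder (ρ : ℂ) : ℝ) / (1 + (ρ : ℂ).im ^ 2)) :=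
    summable_zeroOrder_div_one_add_im_sq.mul_left A₀
  have hnn : ∀ ρ : ZetaZeros.riemannZetaNontrivialZeros,
      0 ≤ (riemannZetaZeroOrder (ρ : ℂ) : ℝ) * ‖weilMellin k ρ‖ := fun ρ ↦
    mul_nonneg (hm ρ) (norm_nonneg _)
  exact (Finset.sum_le_sum fun ρ _ ↦ hle ρ).trans
    (hsum.sum_le_tsum _ fun ρ _ ↦ (hnn ρ).trans (hle ρ))

end Counting

/-! ## The zero bound of `decayTest2` (extracted from part XVI) -/

section NearNull

/-- **Zero side, pointwise.** `|(decayTest2 λ)^(ρ)| ≤ C 2^{-(M(λ)+1)}/(1+γ²)` at every non-trivial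
zero, for `λ ≥ λ₁` (the estimate inside `re_weilQuadratic_decayTest2_le`, recorded pointwise). -/
theorem norm_weilMellin_decayTest2_le :
    ∃ C lam₁ : ℝ, 0 ≤ C ∧ 1 ≤ lam₁ ∧ ∀ lam : ℝ, lam₁ ≤ lam →
      ∀ ρ ∈ ZetaZeros.riemannZetaNontrivialZeros,
        ‖weilMellin (decayTest2 lam) ρ‖ ≤
          C * (1 / 2 : ℝ) ^ (decayM lam + 1) / (1 + ρ.im ^ 2) := by
  obtain ⟨A₁, hA₁, hE⟩ := norm_eMapFn_hFam_le
  set D : ℝ := weilDecayConst (moll 0) with hD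
  have hD0 : 0 ≤ D := weilDecayConst_nonneg _
  refine ⟨2 * A₁ * D, max 1 (4 * fdX), by positivity, le_max_left _ _, fun lam hlam ρ hρ ↦ ?_⟩
  have hlam1 : 1 ≤ lam := (le_max_left _ _).trans hlam
  have hlam0 : 0 < lam := by linarith
  have hlam2 : 4 * fdX ≤ lam ^ 2 := by
    have := (le_max_right _ _).trans hlam
    nlinarith
  set q : ℝ := (1 / 2 : ℝ) ^ (decayM lam + 1) with hq
  have hq0 : 0 ≤ q := by positivity
  have hEq : ∀ u : ℝ, 0 < u → u ≤ 2 / (lam + 1) →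
      ‖eMapFn (hFam (decayM lam)) lam u‖ ≤ A₁ * q * (lam⁻¹ * u) :=
    fun u hu huU ↦ hE lam hlam1 hlam2 u hu huU
  obtain ⟨-, hre, hre1⟩ := mem_riemannZetaNontrivialZeros_iff_holds.1 hρ
  have h1 : ‖weilMellin (winTest (hFam (decayM lam)) lam) ρ‖ ≤ 2 * A₁ * q := by
    have := norm_weilMellin_winTest_le_of_bound (hFam (decayM lam)) (hFam_even _) (hFam_zero _)
      (integral_hFam _) (hFam_eq_zero_of_one_lt _) (by positivity) hlam1 hEq hρ
    calc ‖weilMellin (winTest (hFam (decayM lam)) lam) ρ‖ ≤ 2 * (A₁ * q) / lam ^ 2 := this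
      _ ≤ 2 * (A₁ * q) / 1 := div_le_div_of_nonneg_left (by positivity) one_pos (by nlinarith)
      _ = 2 * A₁ * q := by ring
  have h2 : ‖weilMellin (moll 0) ρ‖ ≤ D / (1 + ρ.im ^ 2) :=
    norm_weilMellin_le (isWeilTest_moll 0) hre.le hre1.le
  have hpos : 0 < 1 + ρ.im ^ 2 := by positivity
  rw [weilMellin_decayTest2 hlam0, norm_mul]
  calc ‖weilMellin (winTest (hFam (decayM lam)) lam) ρ‖ * ‖weilMellin (moll 0) ρ‖
      ≤ (2 * A₁ * q) * (D / (1 + ρ.im ^ 2)) := mul_le_mul h1 h2 (norm_nonneg _) (by positivity)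
    _ = 2 * A₁ * D * q / (1 + ρ.im ^ 2) := by ring

/-- `x e^{-x} ≤ 1` for `x ≥ 0`, in the form `x ≤ e^{x}` rescaled: `λ² e^{-κ λ²} ≤ 1/κ`. -/
theorem sq_mul_exp_neg_le {κ lam : ℝ} (hκ : 0 < κ) :
    lam ^ 2 * Real.exp (-κ * lam ^ 2) ≤ 1 / κ := by
  have h1 : κ * lam ^ 2 ≤ Real.exp (κ * lam ^ 2) := by
    have := Real.add_one_le_exp (κ * lam ^ 2)
    linarith
  rw [show -κ * lam ^ 2 = -(κ * lam ^ 2) by ring, Real.exp_neg, le_div_iff₀ hκ]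
  have hpos : 0 < Real.exp (κ * lam ^ 2) := Real.exp_pos _
  calc lam ^ 2 * (Real.exp (κ * lam ^ 2))⁻¹ * κ = κ * lam ^ 2 / Real.exp (κ * lam ^ 2) := by
        rw [div_eq_mul_inv]
        ring
    _ ≤ 1 := (div_le_one hpos).2 h1

/-- **Unit near-null vectors on the windows `a = log(λ+1)+1`.** For `λ ≥ λ₀` there is a test `k`
on `[-a, a]`, `a = decayRadius λ`, with `‖k‖₂ = 1` and `Z₁(k; T) · e^{a/2}√(2a) ≤ C` for all `T`. -/
theorem exists_unit_nearNull_decayRadius :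
    ∃ C lam₀ : ℝ, 0 ≤ C ∧ 1 ≤ lam₀ ∧ ∀ lam : ℝ, lam₀ ≤ lam → ∃ k : ℝ → ℂ, IsWeilTest k ∧
      tsupport k ⊆ Icc (-decayRadius lam) (decayRadius lam) ∧ ∫ t, ‖k t‖ ^ 2 = 1 ∧
      ∀ T : ℝ, (∑ᶠ ρ ∈ weilZeroIndex T, (riemannZetaZeroOrder ρ : ℝ) * ‖weilMellin k ρ‖) *
        (Real.exp (decayRadius lam / 2) * Real.sqrt (2 * decayRadius lam)) ≤ C := by
  obtain ⟨Cz, lam₁, hCz, hlam₁, hZ⟩ := norm_weilMellin_decayTest2_le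
  obtain ⟨c₀, lam₂, hc₀, hlam₂, hlowM⟩ := norm_weilMellin_decayTest2_two_ge
  set S₁ : ℝ := ∑' ρ : ZetaZeros.riemannZetaNontrivialZeros,
    (riemannZetaZeroOrder (ρ : ℂ) : ℝ) / (1 + (ρ : ℂ).im ^ 2) with hS₁
  have hS₁0 : 0 ≤ S₁ := tsum_zeroOrder_div_one_add_im_sq_nonneg
  set κ₀ : ℝ := Real.log 2 / (4 * fdX) with hκ₀
  have hκ₀0 : 0 < κ₀ := div_pos (Real.log_pos one_lt_two) (by linarith [fdX_pos])
  refine ⟨Cz * S₁ * (32 * Real.exp 3 / c₀) * (1 / κ₀), max lam₁ lam₂, by positivity,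
    hlam₁.trans (le_max_left _ _), fun lam hlam ↦ ?_⟩
  have hl1 : lam₁ ≤ lam := (le_max_left _ _).trans hlam
  have hl2 : lam₂ ≤ lam := (le_max_right _ _).trans hlam
  have hlam1 : 1 ≤ lam := hlam₁.trans hl1
  have hlam0 : 0 < lam := by linarith
  set a := decayRadius lam with ha
  have ha0 : 0 < a := decayRadius_pos hlam0
  set k := decayTest2 lam with hkdef
  have hk : IsWeilTest k := isWeilTest_decayTest2 hlam0
  have hks : tsupport k ⊆ Icc (-a) a := tsupport_decayTest2 hlam0
  set q : ℝ := (1 / 2 : ℝ) ^ (decayM lam + 1) with hq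
  have hq0 : 0 ≤ q := by positivity
  set N : ℝ := ∫ t, ‖k t‖ ^ 2 with hN
  -- the norm from below
  have hk2 : c₀ * lam ^ 2 ≤ ‖weilMellin k 2‖ := hlowM lam hl2
  have hlow : (c₀ * lam ^ 2) ^ 2 * (Real.exp (-(3 * a)) / (2 * a)) ≤ N :=
    (mul_le_mul_of_nonneg_right (pow_le_pow_left₀ (by positivity) hk2 2) (by positivity)).trans
      (integral_norm_sq_ge_of_support hk ha0 hks)
  have hNpos : 0 < N := lt_of_lt_of_le (by positivity) hlow
  -- the normalised vector
  set c : ℝ := (Real.sqrt N)⁻¹ with hc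
  have hc0 : 0 < c := inv_pos.2 (Real.sqrt_pos.2 hNpos)
  have hcn : ‖(c : ℂ)‖ = c := by rw [Complex.norm_real, Real.norm_eq_abs, abs_of_pos hc0]
  refine ⟨fun t ↦ (c : ℂ) * k t, hk.const_mul _, tsupport_mul_subset_right.trans hks, ?_, ?_⟩
  · calc ∫ t, ‖(c : ℂ) * k t‖ ^ 2 = ∫ t, c ^ 2 * ‖k t‖ ^ 2 := by
          congr 1
          funext t
          rw [norm_mul, mul_pow, hcn]
      _ = c ^ 2 * N := integral_const_mul _ _
      _ = 1 := by
          rw [hc, inv_pow, Real.sq_sqrt hNpos.le, inv_mul_cancel₀ hNpos.ne']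
  · intro T
    -- pointwise bound at the zeros for the normalised vector
    have hzero : ∀ ρ ∈ ZetaZeros.riemannZetaNontrivialZeros,
        ‖weilMellin (fun t ↦ (c : ℂ) * k t) ρ‖ ≤ c * (Cz * q) / (1 + ρ.im ^ 2) := by
      intro ρ hρ
      have hρb : ‖weilMellin k ρ‖ ≤ Cz * q / (1 + ρ.im ^ 2) := hZ lam hl1 ρ hρ
      rw [weilMellin_const_mul, norm_mul, hcn]
      calc c * ‖weilMellin k ρ‖ ≤ c * (Cz * q / (1 + ρ.im ^ 2)) :=
            mul_le_mul_of_nonneg_left hρb hc0.le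
        _ = c * (Cz * q) / (1 + ρ.im ^ 2) := by ring
    have hZ₁ := zeroSumAbs_le_of_norm_le_inv hzero T
    -- `c · E(a) · c₀ λ² ≤ 2a e^{2a}` (compare squares)
    set E : ℝ := Real.exp (a / 2) * Real.sqrt (2 * a) with hE
    have hE0 : 0 ≤ E := by positivity
    have hE2 : E ^ 2 = Real.exp a * (2 * a) := by
      rw [hE, mul_pow, Real.sq_sqrt (by positivity), sq, ← Real.exp_add]
      ring_nf
    have hc2 : c ^ 2 = N⁻¹ := by rw [hc, inv_pow, Real.sq_sqrt hNpos.le]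
    have h3 : Real.exp (-(3 * a)) * Real.exp (4 * a) = Real.exp a := by
      rw [← Real.exp_add]
      ring_nf
    have h4 : Real.exp (2 * a) ^ 2 = Real.exp (4 * a) := by
      rw [sq, ← Real.exp_add]
      ring_nf
    have hlow' : (c₀ * lam ^ 2) ^ 2 * Real.exp (-(3 * a)) ≤ N * (2 * a) := by
      have h := hlow
      rw [← mul_div_assoc, div_le_iff₀ (by positivity)] at h
      exact h
    have hsq : (c * E * (c₀ * lam ^ 2)) ^ 2 ≤ (2 * a * Real.exp (2 * a)) ^ 2 := by
      calc (c * E * (c₀ * lam ^ 2)) ^ 2 = c ^ 2 * (E ^ 2 * (c₀ * lam ^ 2) ^ 2) := by ring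
        _ = N⁻¹ * (Real.exp a * (2 * a) * (c₀ * lam ^ 2) ^ 2) := by rw [hc2, hE2]
        _ ≤ (2 * a * Real.exp (2 * a)) ^ 2 := by
            rw [inv_mul_le_iff₀ hNpos]
            calc Real.exp a * (2 * a) * (c₀ * lam ^ 2) ^ 2
                = (c₀ * lam ^ 2) ^ 2 * Real.exp (-(3 * a)) * (Real.exp (4 * a) * (2 * a)) := by
                  rw [← h3]
                  ring
              _ ≤ N * (2 * a) * (Real.exp (4 * a) * (2 * a)) :=
                  mul_le_mul_of_nonneg_right hlow' (by positivity)
              _ = N * (2 * a * Real.exp (2 * a)) ^ 2 := by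
                  rw [← h4]
                  ring
    have hcE : c * E * (c₀ * lam ^ 2) ≤ 2 * a * Real.exp (2 * a) :=
      (pow_le_pow_iff_left₀ (by positivity) (by positivity) two_ne_zero).1 hsq
    -- `2a e^{2a} ≤ 32 e³ λ⁴`, hence `c E ≤ 32 e³ λ² / c₀`, and `λ² q ≤ 1/κ₀`
    have hae : 2 * a * Real.exp (2 * a) ≤ 32 * Real.exp 3 * lam ^ 4 := by
      have h := decayRadius_mul_exp_le hlam1
      have h' : 2 * a * Real.exp (2 * a) ≤ 2 * a * Real.exp (3 * a) := by
        gcongr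
        linarith
      exact h'.trans h
    have hcE' : c * E ≤ 32 * Real.exp 3 * lam ^ 2 / c₀ := by
      have hl2pos : 0 < c₀ * lam ^ 2 := by positivity
      refine le_of_mul_le_mul_right ?_ hl2pos
      calc c * E * (c₀ * lam ^ 2) ≤ 32 * Real.exp 3 * lam ^ 4 := hcE.trans hae
        _ = 32 * Real.exp 3 * lam ^ 2 / c₀ * (c₀ * lam ^ 2) := by
            rw [div_mul_eq_mul_div, eq_div_iff hc₀.ne']
            ring
    have hq2 : lam ^ 2 * q ≤ 1 / κ₀ :=
      (mul_le_mul_of_nonneg_left (half_pow_decayM_le lam) (by positivity)).trans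
        (sq_mul_exp_neg_le hκ₀0)
    have hfin : c * (Cz * q) * S₁ * E ≤ Cz * S₁ * (32 * Real.exp 3 / c₀) * (1 / κ₀) := by
      calc c * (Cz * q) * S₁ * E = Cz * S₁ * q * (c * E) := by ring
        _ ≤ Cz * S₁ * q * (32 * Real.exp 3 * lam ^ 2 / c₀) :=
            mul_le_mul_of_nonneg_left hcE' (by positivity)
        _ = Cz * S₁ * (32 * Real.exp 3 / c₀) * (lam ^ 2 * q) := by ring
        _ ≤ Cz * S₁ * (32 * Real.exp 3 / c₀) * (1 / κ₀) :=
            mul_le_mul_of_nonneg_left hq2 (by positivity)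
    calc (∑ᶠ ρ ∈ weilZeroIndex T,
          (riemannZetaZeroOrder ρ : ℝ) * ‖weilMellin (fun t ↦ (c : ℂ) * k t) ρ‖) * E
        ≤ c * (Cz * q) * S₁ * E := mul_le_mul_of_nonneg_right hZ₁ hE0
      _ ≤ _ := hfin

/-- **Unit near-null vectors on every large window.** There are `C` and `a₁` such that for every
`a ≥ a₁` some test `k` on `[-a, a]` has `‖k‖₂ = 1` and `Z₁(k; T) · e^{a/2}√(2a) ≤ C` for all `T`:
the hypothesis of the visibility criterion concerns only the ANGLE between such vectors and the
ground state, never their existence. -/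
theorem exists_unit_nearNull_window :
    ∃ C a₁ : ℝ, 0 ≤ C ∧ ∀ a : ℝ, a₁ ≤ a → ∃ k : ℝ → ℂ, IsWeilTest k ∧
      tsupport k ⊆ Icc (-a) a ∧ ∫ t, ‖k t‖ ^ 2 = 1 ∧
      ∀ T : ℝ, (∑ᶠ ρ ∈ weilZeroIndex T, (riemannZetaZeroOrder ρ : ℝ) * ‖weilMellin k ρ‖) *
        (Real.exp (a / 2) * Real.sqrt (2 * a)) ≤ C := by
  obtain ⟨C, lam₀, hC, hlam₀, h⟩ := exists_unit_nearNull_decayRadius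
  refine ⟨C, decayRadius lam₀, hC, fun a ha ↦ ?_⟩
  have hl0 : 0 < lam₀ + 1 := by linarith
  set lam : ℝ := Real.exp (a - 1) - 1 with hlam
  have hrad : decayRadius lam = a := by
    show Real.log (Real.exp (a - 1) - 1 + 1) + 1 = a
    rw [sub_add_cancel, Real.log_exp]
    ring
  have hle : lam₀ ≤ lam := by
    have h1 : Real.log (lam₀ + 1) ≤ a - 1 := by
      have : decayRadius lam₀ = Real.log (lam₀ + 1) + 1 := rfl
      linarith
    have h2 : lam₀ + 1 ≤ Real.exp (a - 1) := by
      calc lam₀ + 1 = Real.exp (Real.log (lam₀ + 1)) := (Real.exp_log hl0).symm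
        _ ≤ Real.exp (a - 1) := Real.exp_le_exp.2 h1
    rw [hlam]
    linarith
  obtain ⟨k, hk, hks, hk1, hZ⟩ := h lam hle
  rw [hrad] at hks hZ
  exact ⟨k, hk, hks, hk1, hZ⟩

end NearNull

end Summit.RiemannHypothesis.RiemannHypothesis.Theorems
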